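import Summits.CriticalPhenomena.PercolationContinuityZ3.Theorems.SahiPairwiseTP2LineConnected
import HarnessLib

/-!
# Supports containing an axis slice are line-connected: hypograph supports (Bogso's class) are an instance

Support file of the Sahi cell (`prim-sahi`, literature seat, generation 46; `--supports stmt-CriticalPhenomena-4575`).
Theorems only (no definitions, no named facts, no sorries).

The conjecture of Fallat–Lauritzen–Sadeghi–Uhler–Wermuth–Zwiernik [FallatEtAl2017, §3] is the theorem
`isLogSupermodular_of_pairwiseTP2_of_isLineConnected'` (`Theorems/SahiPairwiseTP2LineConnected.lean`): a nonnegative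
kernel on a product of chains whose support is line-connected and which is TP₂ in every pair of variables is MTP₂.
This file records the simplest sufficient condition for line-connectedness and the published instance it covers.

* `isLineConnected_of_slice_subset`: a set `S ⊆ ∏ᵢ αᵢ` (ι finite) that contains a whole axis slice
  `{z | z i₀ = m}` is line-connected — from any point of `S` move coordinate `i₀` to `m` (one line step), then change
  the remaining coordinates one at a time inside the slice.
* `isLogSupermodular_of_pairwiseTP2_of_slice`: hence a nonnegative pairwise-TP₂ kernel that is non-zero on a whole
  axis slice is MTP₂.
* `isLogSupermodular_of_pairwiseTP2_of_hypograph`: in particular a nonnegative pairwise-TP₂ kernel that is non-zero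
  on a strict hypograph `{x | x i₀ < r x}` whose height function `r` is bounded below by a level `m < r` is MTP₂.
  This is the pointwise form of the class treated by Bogso [Bogso2018, Thm. 2.8] (integrated survival functions
  `C_μ(t, t', x)` of integrable two-parameter processes on `ℝ₊ × ℝ₊ × ℝ`: TP₂ in every pair ⟹ MTP₂, although `C_μ`
  need not have interval support [Bogso2018, Rem. 2.9 and Rem. 3.2]; there the zero set is `{x ≥ r(μ_{(t,t')})}` with
  `r ≥ r(μ_{(0,0)}) > -∞`).  Bogso's proof is specific to that class; here it is one line from the general theorem.

References: [FallatEtAl2017] S. Fallat, S. Lauritzen, K. Sadeghi, C. Uhler, N. Wermuth, P. Zwiernik, Total positivity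
in Markov structures, Ann. Statist. 45 (2017) 1152–1184, §3.  [Bogso2018] A.-M. Bogso, Mean residual life processes
and associated submartingales, J. Theoret. Probab. 33 (2020) 36–64, Thm. 2.8.
-/

namespace Summit.CriticalPhenomena.PercolationContinuityZ3.Theorems.PairwiseTP2LineConnected

open Function Relation
open Literature.Probability.LatticeModels.FKGEqualityChains (IsLogSupermodular)
open Literature.Probability.LatticeModels.MTP2PairwiseCriterion (IsPairwiseTP2)

variable {ι : Type*} {α : ι → Type*} [DecidableEq ι] [∀ i, LinearOrder (α i)] [Fintype ι]

omit [∀ i, LinearOrder (α i)] in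
/-- Inside a set containing the axis slice `{z | z i₀ = m}`, two points OF THE SLICE are joined by changing one
coordinate at a time (never `i₀`), all intermediate points lying in the slice. [this work] -/
theorem reflTransGen_lineAdj_of_slice {S : Set (∀ i, α i)} {i₀ : ι} {m : α i₀}
    (hS : ∀ z : ∀ i, α i, z i₀ = m → z ∈ S) {x y : ∀ i, α i} (hx : x i₀ = m) (hy : y i₀ = m) :
    ReflTransGen (LineAdj S) x y := by
  -- `p s` = `y` on `s`, `x` off `s`; every such point lies in the slice, hence in `S`
  have hp : ∀ s : Finset ι, (fun i => if i ∈ s then y i else x i) i₀ = m := by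
    intro s; by_cases h : i₀ ∈ s <;> simp [h, hx, hy]
  suffices H : ∀ s : Finset ι, ReflTransGen (LineAdj S) x (fun i => if i ∈ s then y i else x i) by
    simpa using H Finset.univ
  intro s
  induction s using Finset.induction_on with
  | empty => simp only [Finset.notMem_empty, if_false]; exact ReflTransGen.refl
  | insert i s his ih =>
    refine ih.tail ⟨hS _ (hp s), hS _ (hp _), i, fun j hj => ?_⟩
    simp [Finset.mem_insert, hj]

omit [∀ i, LinearOrder (α i)] in
/-- **A set containing a whole axis slice is line-connected**: if `{z | z i₀ = m} ⊆ S` then any two points of `S` are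
joined inside `S` by a chain of line-adjacent points (lower/raise coordinate `i₀` to the level `m`, walk inside the
slice, leave it along the `i₀`-axis). [this work] -/
theorem isLineConnected_of_slice_subset {S : Set (∀ i, α i)} (i₀ : ι) (m : α i₀)
    (hS : ∀ z : ∀ i, α i, z i₀ = m → z ∈ S) : IsLineConnected S := by
  intro x hx y hy
  have h1 : LineAdj S x (update x i₀ m) :=
    ⟨hx, hS _ (update_self i₀ m x), i₀, fun j hj => (update_of_ne hj m x).symm⟩
  have h2 : ReflTransGen (LineAdj S) (update x i₀ m) (update y i₀ m) :=
    reflTransGen_lineAdj_of_slice hS (update_self i₀ m x) (update_self i₀ m y)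
  have h3 : LineAdj S (update y i₀ m) y :=
    ⟨hS _ (update_self i₀ m y), hy, i₀, fun j hj => update_of_ne hj m y⟩
  exact ((ReflTransGen.single h1).trans h2).tail h3

/-- **Pairwise TP₂ kernels that are non-zero on a whole axis slice are MTP₂.**  (The slice makes the support
line-connected; then [FallatEtAl2017, §3 conjecture] = `isLogSupermodular_of_pairwiseTP2_of_isLineConnected'`.)
[this work] -/
theorem isLogSupermodular_of_pairwiseTP2_of_slice {μ : (∀ i, α i) → ℝ} (h0 : ∀ z, 0 ≤ μ z) (i₀ : ι) (m : α i₀)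
    (hm : ∀ z : ∀ i, α i, z i₀ = m → μ z ≠ 0) (h : IsPairwiseTP2 μ) : IsLogSupermodular μ :=
  isLogSupermodular_of_pairwiseTP2_of_isLineConnected' h0 (isLineConnected_of_slice_subset i₀ m hm) h

/-- **Hypograph supports (Bogso's class, pointwise form).**  A nonnegative kernel on a finite product of chains that is
TP₂ in every pair of variables and is non-zero at every point of a strict hypograph `{x | x i₀ < r x}` in the
direction `i₀`, where the height `r` admits a strict lower level `m` (`m < r z` for all `z`), is MTP₂ — whatever its
zeros above the hypograph.  For the integrated survival functions of [Bogso2018, Thm. 2.8] (`ι = 3`, chains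
`ℝ₊, ℝ₊, ℝ`, zero set `{x ≥ r(μ_{(t,t')})}`, `r ≥ r(μ_{(0,0)}) > -∞`) take `i₀` = the space coordinate and any
`m < r(μ_{(0,0)})`. [this work] -/
theorem isLogSupermodular_of_pairwiseTP2_of_hypograph {μ : (∀ i, α i) → ℝ} (h0 : ∀ z, 0 ≤ μ z) {i₀ : ι}
    (r : (∀ i, α i) → α i₀) (m : α i₀) (hm : ∀ z, m < r z) (hsupp : ∀ x, x i₀ < r x → μ x ≠ 0)
    (h : IsPairwiseTP2 μ) : IsLogSupermodular μ :=
  isLogSupermodular_of_pairwiseTP2_of_slice h0 i₀ m (fun z hz => hsupp z (by rw [hz]; exact hm z)) h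

/-- Sanity check (kernel instance of the hypograph theorem): kernels on `Fin 3 → ℕ` that are non-zero on the strict
hypograph `{x | x 2 < x 0 ⊓ x 1 + 1}` (height `r x = x 0 ⊓ x 1 + 1 > 0 = m`); such supports contain `(0,0,0)` and
`(5,5,3)` but need not contain `(0,0,3)`, so they need not have interval support. -/
example {μ : (Fin 3 → ℕ) → ℝ} (h0 : ∀ z, 0 ≤ μ z)
    (hsupp : ∀ x : Fin 3 → ℕ, x 2 < x 0 ⊓ x 1 + 1 → μ x ≠ 0) (h : IsPairwiseTP2 μ) : IsLogSupermodular μ :=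
  isLogSupermodular_of_pairwiseTP2_of_hypograph h0 (i₀ := (2 : Fin 3)) (fun x => x 0 ⊓ x 1 + 1) 0
    (fun _ => Nat.succ_pos _) hsupp h

end Summit.CriticalPhenomena.PercolationContinuityZ3.Theorems.PairwiseTP2LineConnected
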